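import Summits.ABC.IUTFork.Joshi.ATS4LogDiffConductor
import Literature.NumberTheory.NumberFields.RelativeDifferentExponents
import Literature.IUT.LogVolume.DifferentDivisorTower
import HarnessLib

/-!
# Joshi, *Arithmetic Teichmüller Spaces IV* (arXiv:2403.10430v2) Thm. 4.6.1, eq. (4.6.4)/(4.6.11): the Galois-case upper bound
# `τ_{w|v} ≤ e_{w|v}·ord_v(e_{w|v})` in the PRINTED form — PROVED over Mathlib number fields

Proof-only companion of `Joshi/ATS4LogDiffConductor.lean` (abc-iut cell, branch E, rung LADDER-ABC:A2.E; seat abc-iut-E-t27,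
slot T-27). **No side is taken** on [IUTchIII] Cor. 3.12, on Joshi's claims, or on Mochizuki's reports on them; the source is an
unrefereed arXiv preprint. Locators «p.N l.M» refer to the render `HOME/lit/renders/Joshi-arxiv-2403.10430/` (v2).

The typed `TauBounds L M` bounds the wild excess by `e_{w|v}·ord_v(e_{w|v})` ((4.6.4) p.47 l.20–24, «τ_{w|v} ∈ [1, e_{w|v}·
ord_v(e_{w|v})]»; (4.6.11) p.48 l.58 «ord_v(e_{w|v}) = e_{v|p}·ord_p(e_{w|v})»), `ord_v` the exponent on `𝓞_L`. The companion
`ATS4LogDiffConductorTame.lean` proved the GALOIS-case bound in the form `τ_{w|v} ≤ ord_w((e_{w|v})·𝓞_M)` ([Bombieri–Gubler 2006,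
B.2.11] in the tree). Here the two forms are identified — `ord_w((n)·𝓞_M) = e_{w|v}·ord_v((n)·𝓞_L)` for `n ≥ 1`
(`ordIdeal_span_natCast_eq_mul`: the tree's `ord_w((n)) = e(w|p)·v_p(n)` on both levels and Mathlib's tower law
`e(w|p) = e(v|p)·e(w|v)`, `Ideal.ramificationIdx_tower`) — so that the Galois-case upper bound holds in EXACTLY the typed /
printed shape (`tau_le_of_isGalois`): for `M/L` Galois, `τ_{w|v} ≤ e_{w|v}·ord_v(e_{w|v})` at every prime `w`. Also (4.6.11)
itself: `ordIdeal_span_natCast` (`ord_v((n)) = e(v|p)·v_p(n)`). The non-Galois case ([Bombieri–Gubler 2006, B.2.12]) stays the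
typed hypothesis. Theorems only; standard axioms; no `sorry`, instance, notation or new `Prop` fact.
[claim: Joshi2024ATS4, status: disputed] (provenance of the typed items; nothing endorsed).
-/

noncomputable section

namespace Summit.ABC.IUTFork.Joshi.ATS4

namespace LogDiffCond

open NumberField IsDedekindDomain Ideal Module UniqueFactorizationMonoid
open Literature.NumberTheory.NumberFields (multiplicity_span_natCast multiplicity_differentIdeal_succ_le_of_isGalois)

variable (L M : Type*) [Field L] [NumberField L] [Field M] [NumberField M] [Algebra L M]

/-! ### Glue (private copies; public versions in `Joshi/ATS4LogDiffConductorIdentity.lean`) -/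

omit [NumberField L] in
/-- `e_{w|v}`: Mathlib `ramificationIdx'` over `w ∩ 𝓞_L` = `Ideal.ramificationIdx` over `𝓞_L`. [folklore] -/
private theorem relRamIdx_eq' (w : HeightOneSpectrum (𝓞 M)) : relRamIdx L M w = w.asIdeal.ramificationIdx (𝓞 L) := by
  haveI := w.isPrime
  exact Ideal.ramificationIdx'_eq_ramificationIdx (w.asIdeal.under (𝓞 L)) w.asIdeal (w.under (𝓞 L)).ne_bot

/-- `ordIdeal` is Mathlib's `multiplicity` for a nonzero ideal. [folklore] -/
private theorem ordIdeal_eq_multiplicity' (M : Type*) [Field M] [NumberField M] (w : HeightOneSpectrum (𝓞 M))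
    {I : Ideal (𝓞 M)} (hI : I ≠ ⊥) : ordIdeal w I = multiplicity w.asIdeal I := by
  classical
  rw [ordIdeal, Ideal.count_associates_factors_eq hI w.isPrime w.ne_bot,
    UniqueFactorizationMonoid.multiplicity_eq_count_normalizedFactors w.irreducible hI, normalize_eq]

/-! ### (4.6.11): `ord((n)) = e(·|p)·v_p(n)`, and the extension law `ord_w((n)·𝓞_M) = e_{w|v}·ord_v((n)·𝓞_L)` -/

/-- **(4.6.11)** (p.48 l.58 «ord_v(e_{w|v}) = e_{v|p}·ord_p(e_{w|v})»), for any `n ≥ 1` and any prime `w` of a number field `M`: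
`ord_w((n)·𝓞_M) = e(w|p)·v_p(n)`, `p` the residue characteristic of `w` (the tree's `multiplicity_span_natCast`).
[cite: NeukirchANT1999, Ch. I (8.2)] -/
theorem ordIdeal_span_natCast (M : Type*) [Field M] [NumberField M] (w : HeightOneSpectrum (𝓞 M)) {n : ℕ} (hn : n ≠ 0) :
    ordIdeal w (Ideal.span {(n : 𝓞 M)}) = w.asIdeal.ramificationIdx ℤ * n.factorization (Ideal.absNorm (w.asIdeal.under ℤ)) := by
  haveI := w.isMaximal
  have hspan : Ideal.span {(n : 𝓞 M)} ≠ ⊥ := by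
    rw [Ne, Ideal.span_singleton_eq_bot, Nat.cast_eq_zero]; exact hn
  rw [ordIdeal_eq_multiplicity' M w hspan]
  exact multiplicity_span_natCast M w.asIdeal hn

omit [NumberField M] in
/-- Tower law `e(w|p) = e(v|p)·e(w|v)` for `v = w ∩ 𝓞_L` (Mathlib `Ideal.ramificationIdx_tower`).
[cite: NeukirchANT1999, Ch. III (1.6)] -/
theorem ramificationIdx_int_eq_mul (w : HeightOneSpectrum (𝓞 M)) :
    w.asIdeal.ramificationIdx ℤ = (w.under (𝓞 L)).asIdeal.ramificationIdx ℤ * w.asIdeal.ramificationIdx (𝓞 L) := by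
  rw [HeightOneSpectrum.under_asIdeal]
  exact Ideal.ramificationIdx_tower (R := ℤ) (w.asIdeal.under (𝓞 L)) w.asIdeal

omit [NumberField L] [NumberField M] in
/-- The residue characteristic of `w` is that of `v = w ∩ 𝓞_L` (`(w ∩ 𝓞_L) ∩ ℤ = w ∩ ℤ`). [folklore] -/
theorem absNorm_under_int_eq (w : HeightOneSpectrum (𝓞 M)) :
    Ideal.absNorm ((w.under (𝓞 L)).asIdeal.under ℤ) = Ideal.absNorm (w.asIdeal.under ℤ) := by
  rw [HeightOneSpectrum.under_asIdeal, Ideal.under_under]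

/-- **Extension law**: `ord_w((n)·𝓞_M) = e_{w|v}·ord_v((n)·𝓞_L)` for `n ≥ 1` (both sides are `e(·|p)·v_p(n)`, tower law).
[cite: NeukirchANT1999, Ch. I (8.2)] -/
theorem ordIdeal_span_natCast_eq_mul (w : HeightOneSpectrum (𝓞 M)) {n : ℕ} (hn : n ≠ 0) :
    ordIdeal w (Ideal.span {(n : 𝓞 M)}) = relRamIdx L M w * ordIdeal (w.under (𝓞 L)) (Ideal.span {(n : 𝓞 L)}) := by
  rw [ordIdeal_span_natCast M w hn, ordIdeal_span_natCast L (w.under (𝓞 L)) hn, absNorm_under_int_eq,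
    ramificationIdx_int_eq_mul L M w, relRamIdx_eq']
  ring

/-! ### The Galois-case upper bound in the printed form -/

/-- **[J-IV] (4.6.4), upper bound, GALOIS case, printed form — PROVED**: for `M/L` Galois and every prime `w` of `M`,
`τ_{w|v} ≤ e_{w|v}·ord_v(e_{w|v})` (p.47 l.20–24; [Bombieri–Gubler 2006, B.2.11] `ord_w 𝔡_{M/L} ≤ e − 1 + ord_w((e))` in the
tree, plus the extension law). The second conjunct of the typed `TauBounds`, upper half, for Galois extensions; the non-Galois
case (B.2.12) stays the hypothesis. [cite: BombieriGubler2006, Thm B.2.11] -/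
theorem tau_le_of_isGalois [IsGalois L M] (w : HeightOneSpectrum (𝓞 M)) :
    tau L M w ≤ relRamIdx L M w * ordIdeal (w.under (𝓞 L)) (Ideal.span {((relRamIdx L M w : ℕ) : 𝓞 L)}) := by
  haveI := w.isMaximal
  have he0 : relRamIdx L M w ≠ 0 := by
    rw [relRamIdx_eq']; exact (Ideal.ramificationIdx_pos w.asIdeal (𝓞 L)).ne'
  rw [← ordIdeal_span_natCast_eq_mul L M w he0]
  -- now the `ATS4LogDiffConductorTame` form: `τ ≤ ord_w((e)·𝓞_M)`
  have h := multiplicity_differentIdeal_succ_le_of_isGalois L M w.asIdeal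
  have hspan : Ideal.span {((w.asIdeal.ramificationIdx (𝓞 L) : ℕ) : 𝓞 M)} ≠ ⊥ := by
    rw [Ne, Ideal.span_singleton_eq_bot, Nat.cast_eq_zero, ← relRamIdx_eq']; exact he0
  have hD : differentIdeal (𝓞 L) (𝓞 M) ≠ ⊥ := differentIdeal_ne_bot
  rw [relRamIdx_eq', ordIdeal_eq_multiplicity' M w hspan, tau, relDiffExp, ordIdeal_eq_multiplicity' M w hD, relRamIdx_eq']
  omega

end LogDiffCond

end Summit.ABC.IUTFork.Joshi.ATS4

end
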